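import Summits.Ventures.CertifiedManyBodySolver.Rows.DopedTLCorrFilling
import Summits.Ventures.CertifiedManyBodySolver.Rows.DopedTLCorrBox
import Summits.Ventures.CertifiedManyBodySolver.Observables.RungLeavesStiffnessAnchor
import HarnessLib

/-!
# Ventures/CertifiedManyBodySolver — Observables/StiffnessFillingSegmentLeaf.lean

HONEST FRAMING: one-sided certified CEILINGS on the uniform flux stiffness (helicity modulus / superfluid weight),
transported along the FILLING axis of a material box; a ceiling never speaks to the presence of order; not a `T_c`
estimate, not a superconductivity verdict; no stiffness floor follows from equal-time data and an energy window
(`Observables/StiffnessNoFloor.lean`). Every leaf below is CONDITIONAL on the row predicate it names.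

Cell `pub/hubbard-downfold` (MO-S1 ↔ S2 seam, D-0096; D-0150 line L-DF2 «box ↦ certified word»), seat
hubbard-downfold-unc-2 (filling direction), `prover-hubbard-downfold-unc-2-g12-0`. WHY: the director's M2(b) target
(2026-08-27) is a CERTIFIED stiffness ceiling over the WHOLE La₂CuO₄ parent box; the box of record `boxLa214E_M13v110`
carries the filling INTERVAL `n ∈ [0.99, 1.01]` (`Downfold/BoxesLa214V110.lean`). The anchor-generic leaves of
`Observables/RungLeavesStiffnessAnchor.lean` discharge `ObsStiffnessSeqCeilingAt tp U n c` at ONE density from a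
certified row; the `U`-ray (`…_tp0_on_ray_…`, Griffiths monotonicity) moves it up in `U`; hubbard-tc's
`ObsStiffnessSeqCeilingAt_box_of_corners_le` moves the KINEMATIC (one-body) ceiling over a `(t', n)` box; nothing
moved a CERTIFIED (window-based) ceiling along the density. With the density-parametrised rows of
`Rows/DopedTLCorrFilling.lean` (what one window certificate proves at every filling; the box window row it yields on
a filling segment `{U} × {t'} × [n₁, n₂]`) this file types the FILLING-SEGMENT LEAVES:

* §1 `ObsStiffnessSeqCeilingAt_on_segment_of_oddMomentTT_orbitLowerBoxRowW` / `…BoxRow` — a box (window) row on a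
  filling segment for the odd-moment / `t–t'` f-sum word `−X_λ = −oddMomentObsTT tp U λ` (the shape of hubbard-algo's
  `boxdual/0` words AND of a re-priced point certificate, `Rows/DopedTLCorrFilling.lean` §C), with its energy window
  DISCHARGED on the segment (chord caps by convexity in `n`, floors by a certified device), gives
  `ObsStiffnessSeqCeilingAt tp U x c` for EVERY density `x ∈ [n₁, n₂]` and every `c ≥ −r`; `…_tp0_…_of_kinWord_…` the
  `t' = 0` kinetic-word (`kinlo`) form with the f-sum factor `¼`;
* §2 `ObsStiffnessSeqCeilingAt_on_segment_of_affineOddMomentTT_orbitRowN` — straight from an AFFINE-N row (a point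
  certificate printed with its density slope `s`) + two certified caps `u₁, u₂` at the segment's ends + a floor valid
  on the segment: the leaf on the whole segment at the constant `c = max(−v₁, −v₂)`,
  `vᵢ = q + s(nᵢ − n₀) + κhi(hi − uᵢ) + κlo(lo' − lo)` — two endpoint evaluations, zero new solves («a filling box is
  decided at its two ends»); `…_tp0_…_of_affineKinWord_orbitRowN` the kinetic-word form;
* §3 the `(U-RAY) × (FILLING SEGMENT)` RECTANGLE at `t' = 0`: ONE kinetic-word certificate at the anchor `(U₀, n₀, 0)`
  (affine-N row, or a discharged segment box row at `U₀`) serves EVERY `U ≥ U₀` and EVERY density of the segment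
  (`ObsStiffnessSeqCeilingAt_tp0_on_rectangle_of_…`): the density leg of this file composed with the `U`-ray of
  `Observables/RungLeavesStiffnessAnchor.lean` §5 — the two directions in which a certified f-sum ceiling moves for free.

Not here: the `t'` direction (the f-sum word itself depends on `t'`; the stationarity rows are Hamiltonian-specific —
`Literature/…/HubbardTTPrimeWindowCertificateAnchorTransport` prices it per certificate), thermal leaves, numbers.

References: D. J. Scalapino, S. R. White, S.-C. Zhang, PRB 47 (1993) 7995, §II [ScalapinoWhiteZhang1993];
J. Wang et al., PRX 14 (2024) 031006, §III [WangEtAl2024]; S. Boyd, L. Vandenberghe, Convex Optimization (2004) §5.6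
[BoydVandenberghe2004]; R. B. Griffiths, J. Math. Phys. 7 (1966) 1215 §II [Griffiths1966]; D. Ruelle, Statistical
Mechanics: Rigorous Results (1969) §3.3 [Ruelle1969].
-/

noncomputable section

namespace Summit.Ventures.CertifiedManyBodySolver.Observables

open Matrix Finset Filter Topology
open Literature.MathematicalPhysics.QuantumLattice
open Literature.MathematicalPhysics.QuantumLattice.ThermodynamicLimit
open Literature.Probability.LatticeModels
open scoped ComplexOrder ComplexConjugate Topology BigOperators

/-! ## §1 Segment leaves from a box row on a filling segment (window discharged there) -/

section BoxRow

variable {tp U : ℝ} {n₁ n₂ : ℝ} {r : ℚ} {S : Finset (DihedralGroup 4)} {flo cap : (Fin 3 → ℝ) → ℝ}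

/-- **Odd-moment / `t–t'` f-sum leaf on a filling SEGMENT from a box WINDOW row.** `S ⊆ D₄` nonempty, `0 ≤ n₁`, `n₂ ≤ 2`;
a box window row `SquareTTPrimeCorrOrbitLowerBoxRowW ![U,tp,n₁] ![U,tp,n₂] flo cap r S (box 2 7) (−X_λ)` whose window is
DISCHARGED on the segment (`flo θ ≤ e₀(θ) ≤ cap θ` at every point): then `ObsStiffnessSeqCeilingAt tp U x c` for every
density `x ∈ [n₁, n₂]` and every `c ≥ −r`. [cite: ScalapinoWhiteZhang1993, §II] -/
theorem ObsStiffnessSeqCeilingAt_on_segment_of_oddMomentTT_orbitLowerBoxRowW (lam : ℝ) (hS : S.Nonempty)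
    (hn₁ : 0 ≤ n₁) (hn₂ : n₂ ≤ 2)
    (h : SquareTTPrimeCorrOrbitLowerBoxRowW ![U, tp, n₁] ![U, tp, n₂] flo cap r S (box 2 7)
      (-oddMomentObsTT tp U lam))
    (hflo : ∀ θ ∈ Set.Icc ![U, tp, n₁] ![U, tp, n₂], flo θ ≤ energyDensityTT' 1 (θ 1) (θ 0) (θ 2))
    (hcap : ∀ θ ∈ Set.Icc ![U, tp, n₁] ![U, tp, n₂], energyDensityTT' 1 (θ 1) (θ 0) (θ 2) ≤ cap θ)
    (c : ℚ) (hc : -r ≤ c) :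
    ∀ x ∈ Set.Icc n₁ n₂, ObsStiffnessSeqCeilingAt tp U x c := by
  intro x hx
  obtain ⟨u, hu⟩ := exists_rat_gt (energyDensityTT' 1 tp U x)
  exact ObsStiffnessSeqCeilingAt_of_oddMomentTT_orbitLowerRow tp U x lam S hS (hn₁.trans hx.1) (hx.2.trans hn₂)
    (h.orbitLowerRow_of_segment hflo hcap hx u) hu.le c hc

/-- **The same from a box row with a cap only** (`SquareTTPrimeCorrOrbitLowerBoxRow`, the shape of hubbard-algo's
`boxdual/0` claim nodes), the cap discharged on the segment. [cite: ScalapinoWhiteZhang1993, §II] -/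
theorem ObsStiffnessSeqCeilingAt_on_segment_of_oddMomentTT_orbitLowerBoxRow (lam : ℝ) (hS : S.Nonempty)
    (hn₁ : 0 ≤ n₁) (hn₂ : n₂ ≤ 2)
    (h : SquareTTPrimeCorrOrbitLowerBoxRow ![U, tp, n₁] ![U, tp, n₂] cap r S (box 2 7) (-oddMomentObsTT tp U lam))
    (hcap : ∀ θ ∈ Set.Icc ![U, tp, n₁] ![U, tp, n₂], energyDensityTT' 1 (θ 1) (θ 0) (θ 2) ≤ cap θ)
    (c : ℚ) (hc : -r ≤ c) :
    ∀ x ∈ Set.Icc n₁ n₂, ObsStiffnessSeqCeilingAt tp U x c := by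
  intro x hx
  obtain ⟨u, hu⟩ := exists_rat_gt (energyDensityTT' 1 tp U x)
  have hθ := vec3_mem_fillingSegment (U := U) (tp := tp) hx
  have hrow : SquareTTPrimeCorrOrbitLowerRow tp U x u r S (box 2 7) (-oddMomentObsTT tp U lam) := by
    intro ω Ls ψ hLs hψ hψ1 hω _
    have hh := h.uncond hcap _ hθ ω Ls ψ hLs
    simp only [Matrix.cons_val_zero, Matrix.cons_val_one, Matrix.head_cons, Matrix.cons_val_two,
      Matrix.tail_cons] at hh
    exact hh hψ hψ1 hω
  exact ObsStiffnessSeqCeilingAt_of_oddMomentTT_orbitLowerRow tp U x lam S hS (hn₁.trans hx.1) (hx.2.trans hn₂)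
    hrow hu.le c hc

/-- **`t' = 0` kinetic-word (`kinlo`) leaf on a filling SEGMENT from a box WINDOW row** on `kinWord` (window discharged on
the segment): `ObsStiffnessSeqCeilingAt 0 U x c` for every `x ∈ [n₁, n₂]` (`n₂ ≤ 2`) and every `c ≥ −r/4` (f-sum).
[cite: ScalapinoWhiteZhang1993, §II] -/
theorem ObsStiffnessSeqCeilingAt_tp0_on_segment_of_kinWord_orbitLowerBoxRowW (hn₂ : n₂ ≤ 2)
    (h : SquareTTPrimeCorrOrbitLowerBoxRowW ![U, 0, n₁] ![U, 0, n₂] flo cap r Finset.univ kinWindow kinWord)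
    (hflo : ∀ θ ∈ Set.Icc ![U, 0, n₁] ![U, 0, n₂], flo θ ≤ energyDensityTT' 1 (θ 1) (θ 0) (θ 2))
    (hcap : ∀ θ ∈ Set.Icc ![U, 0, n₁] ![U, 0, n₂], energyDensityTT' 1 (θ 1) (θ 0) (θ 2) ≤ cap θ)
    (c : ℚ) (hc : -r / 4 ≤ c) :
    ∀ x ∈ Set.Icc n₁ n₂, ObsStiffnessSeqCeilingAt 0 U x c := by
  intro x hx
  obtain ⟨u, hu⟩ := exists_rat_gt (energyDensityTT' 1 0 U x)
  exact ObsStiffnessSeqCeilingAt_tp0_of_kinWord_orbitLowerRow (hx.2.trans hn₂)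
    (h.orbitLowerRow_of_segment hflo hcap hx u) hu.le c hc

/-- **`t' = 0` kinetic-word leaf on a filling segment from a cap-only box row** (`boxdual/0` shape), cap discharged on the
segment. [cite: ScalapinoWhiteZhang1993, §II] -/
theorem ObsStiffnessSeqCeilingAt_tp0_on_segment_of_kinWord_orbitLowerBoxRow (hn₂ : n₂ ≤ 2)
    (h : SquareTTPrimeCorrOrbitLowerBoxRow ![U, 0, n₁] ![U, 0, n₂] cap r Finset.univ kinWindow kinWord)
    (hcap : ∀ θ ∈ Set.Icc ![U, 0, n₁] ![U, 0, n₂], energyDensityTT' 1 (θ 1) (θ 0) (θ 2) ≤ cap θ)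
    (c : ℚ) (hc : -r / 4 ≤ c) :
    ∀ x ∈ Set.Icc n₁ n₂, ObsStiffnessSeqCeilingAt 0 U x c := by
  intro x hx
  obtain ⟨u, hu⟩ := exists_rat_gt (energyDensityTT' 1 0 U x)
  have hθ := vec3_mem_fillingSegment (U := U) (tp := (0 : ℝ)) hx
  have hrow : SquareTTPrimeCorrOrbitLowerRow 0 U x u r Finset.univ kinWindow kinWord := by
    intro ω Ls ψ hLs hψ hψ1 hω _
    have hh := h.uncond hcap _ hθ ω Ls ψ hLs
    simp only [Matrix.cons_val_zero, Matrix.cons_val_one, Matrix.head_cons, Matrix.cons_val_two,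
      Matrix.tail_cons] at hh
    exact hh hψ hψ1 hω
  exact ObsStiffnessSeqCeilingAt_tp0_of_kinWord_orbitLowerRow (hx.2.trans hn₂) hrow hu.le c hc

end BoxRow

/-! ## §2 Segment leaves straight from an AFFINE-N row: two endpoint evaluations, zero new solves -/

section AffineN

variable {tp U : ℝ} {q hi lo κhi κlo s n₀ : ℚ}

/-- The endpoint arithmetic: `c ≥ −v₁`, `c ≥ −v₂` ⇒ `−min(v₁, v₂) ≤ c`. [folklore] -/
theorem neg_min_le_of_neg_le {v₁ v₂ c : ℚ} (h₁ : -v₁ ≤ c) (h₂ : -v₂ ≤ c) : -min v₁ v₂ ≤ c := by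
  rcases le_total v₁ v₂ with h | h
  · rw [min_eq_left h]; exact h₁
  · rw [min_eq_right h]; exact h₂

/-- **Odd-moment / `t–t'` f-sum leaf on a filling SEGMENT from ONE affine-N row** (a point certificate at `(tp, U, n₀)`
printed with its density slope `s`; `U ≥ 0`, `κhi, κlo ≥ 0`, `0 ≤ n₁ < n₂ < 2`), two certified CAPS `e₀(tp,U,nᵢ) ≤ uᵢ` at the
segment's ends and a FLOOR `lo'` valid on the segment: `ObsStiffnessSeqCeilingAt tp U x c` for every `x ∈ [n₁, n₂]` and
every `c` above both endpoint values `−vᵢ`, `vᵢ = q + s(nᵢ − n₀) + κhi(hi − uᵢ) + κlo(lo' − lo)` (inside: the chord cap by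
convexity in `n`, the re-priced value affine in `n`). [cite: BoydVandenberghe2004, §5.6] -/
theorem ObsStiffnessSeqCeilingAt_on_segment_of_affineOddMomentTT_orbitRowN (lam : ℝ) {S : Finset (DihedralGroup 4)}
    (hS : S.Nonempty) (hU : 0 ≤ U)
    (h : SquareTTPrimeCorrAffineOrbitLowerRowN tp U q hi lo κhi κlo s n₀ S (box 2 7) (-oddMomentObsTT tp U lam))
    (hκhi : 0 ≤ κhi) (hκlo : 0 ≤ κlo) {n₁ n₂ u₁ u₂ lo' : ℚ} (hn₁ : 0 ≤ n₁) (h12 : n₁ < n₂) (hn₂ : n₂ < 2)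
    (hu₁ : energyDensityTT' 1 tp U n₁ ≤ ((u₁ : ℚ) : ℝ)) (hu₂ : energyDensityTT' 1 tp U n₂ ≤ ((u₂ : ℚ) : ℝ))
    (hlo' : ∀ x ∈ Set.Icc ((n₁ : ℚ) : ℝ) ((n₂ : ℚ) : ℝ), ((lo' : ℚ) : ℝ) ≤ energyDensityTT' 1 tp U x)
    (c : ℚ) (hc₁ : -(q + s * (n₁ - n₀) + κhi * (hi - u₁) + κlo * (lo' - lo)) ≤ c)
    (hc₂ : -(q + s * (n₂ - n₀) + κhi * (hi - u₂) + κlo * (lo' - lo)) ≤ c) :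
    ∀ x ∈ Set.Icc ((n₁ : ℚ) : ℝ) ((n₂ : ℚ) : ℝ), ObsStiffnessSeqCeilingAt tp U x c := by
  have hbox := h.orbitLowerBoxRowW_segment_chord hκhi hκlo hn₁ h12 hn₂
    (r' := min (q + s * (n₁ - n₀) + κhi * (hi - u₁) + κlo * (lo' - lo))
      (q + s * (n₂ - n₀) + κhi * (hi - u₂) + κlo * (lo' - lo))) (min_le_left _ _) (min_le_right _ _)
  have hflo : ∀ θ ∈ Set.Icc ![U, tp, ((n₁ : ℚ) : ℝ)] ![U, tp, ((n₂ : ℚ) : ℝ)],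
      (fun _ : Fin 3 → ℝ => ((lo' : ℚ) : ℝ)) θ ≤ energyDensityTT' 1 (θ 1) (θ 0) (θ 2) := by
    intro θ hθ
    obtain ⟨h0, h1, hx1, hx2⟩ := mem_fillingSegment_iff.1 hθ
    rw [h0, h1]
    exact hlo' (θ 2) ⟨hx1, hx2⟩
  have hcap := energyDensityTT'_le_chordCap_of_mem_fillingSegment (tp := tp) hU
    (show (0 : ℝ) ≤ ((n₁ : ℚ) : ℝ) by exact_mod_cast hn₁) (show ((n₁ : ℚ) : ℝ) < ((n₂ : ℚ) : ℝ) by exact_mod_cast h12)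
    (show ((n₂ : ℚ) : ℝ) < 2 by exact_mod_cast hn₂) hu₁ hu₂
  exact ObsStiffnessSeqCeilingAt_on_segment_of_oddMomentTT_orbitLowerBoxRowW lam hS (by exact_mod_cast hn₁)
    (le_of_lt (by exact_mod_cast hn₂)) hbox hflo hcap c (neg_min_le_of_neg_le hc₁ hc₂)

/-- **`t' = 0` kinetic-word leaf on a filling SEGMENT from ONE affine-N `kinWord` row** at `(U, n₀, 0)` with density slope
`s`, two caps and a floor on the segment: `ObsStiffnessSeqCeilingAt 0 U x c` for every `x ∈ [n₁, n₂]` and every `c` with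
`−vᵢ/4 ≤ c` (`i = 1, 2`). [cite: BoydVandenberghe2004, §5.6] -/
theorem ObsStiffnessSeqCeilingAt_tp0_on_segment_of_affineKinWord_orbitRowN (hU : 0 ≤ U)
    (h : SquareTTPrimeCorrAffineOrbitLowerRowN 0 U q hi lo κhi κlo s n₀ Finset.univ kinWindow kinWord)
    (hκhi : 0 ≤ κhi) (hκlo : 0 ≤ κlo) {n₁ n₂ u₁ u₂ lo' : ℚ} (hn₁ : 0 ≤ n₁) (h12 : n₁ < n₂) (hn₂ : n₂ < 2)
    (hu₁ : energyDensityTT' 1 0 U n₁ ≤ ((u₁ : ℚ) : ℝ)) (hu₂ : energyDensityTT' 1 0 U n₂ ≤ ((u₂ : ℚ) : ℝ))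
    (hlo' : ∀ x ∈ Set.Icc ((n₁ : ℚ) : ℝ) ((n₂ : ℚ) : ℝ), ((lo' : ℚ) : ℝ) ≤ energyDensityTT' 1 0 U x)
    (c : ℚ) (hc₁ : -(q + s * (n₁ - n₀) + κhi * (hi - u₁) + κlo * (lo' - lo)) / 4 ≤ c)
    (hc₂ : -(q + s * (n₂ - n₀) + κhi * (hi - u₂) + κlo * (lo' - lo)) / 4 ≤ c) :
    ∀ x ∈ Set.Icc ((n₁ : ℚ) : ℝ) ((n₂ : ℚ) : ℝ), ObsStiffnessSeqCeilingAt 0 U x c := by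
  have hbox := h.orbitLowerBoxRowW_segment_chord hκhi hκlo hn₁ h12 hn₂
    (r' := min (q + s * (n₁ - n₀) + κhi * (hi - u₁) + κlo * (lo' - lo))
      (q + s * (n₂ - n₀) + κhi * (hi - u₂) + κlo * (lo' - lo))) (min_le_left _ _) (min_le_right _ _)
  have hflo : ∀ θ ∈ Set.Icc ![U, (0 : ℝ), ((n₁ : ℚ) : ℝ)] ![U, (0 : ℝ), ((n₂ : ℚ) : ℝ)],
      (fun _ : Fin 3 → ℝ => ((lo' : ℚ) : ℝ)) θ ≤ energyDensityTT' 1 (θ 1) (θ 0) (θ 2) := by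
    intro θ hθ
    obtain ⟨h0, h1, hx1, hx2⟩ := mem_fillingSegment_iff.1 hθ
    rw [h0, h1]
    exact hlo' (θ 2) ⟨hx1, hx2⟩
  have hcap := energyDensityTT'_le_chordCap_of_mem_fillingSegment (tp := (0 : ℝ)) hU
    (show (0 : ℝ) ≤ ((n₁ : ℚ) : ℝ) by exact_mod_cast hn₁) (show ((n₁ : ℚ) : ℝ) < ((n₂ : ℚ) : ℝ) by exact_mod_cast h12)
    (show ((n₂ : ℚ) : ℝ) < 2 by exact_mod_cast hn₂) hu₁ hu₂
  have hmin : -min (q + s * (n₁ - n₀) + κhi * (hi - u₁) + κlo * (lo' - lo))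
      (q + s * (n₂ - n₀) + κhi * (hi - u₂) + κlo * (lo' - lo)) / 4 ≤ c := by
    rcases le_total (q + s * (n₁ - n₀) + κhi * (hi - u₁) + κlo * (lo' - lo))
        (q + s * (n₂ - n₀) + κhi * (hi - u₂) + κlo * (lo' - lo)) with hle | hle
    · rw [min_eq_left hle]; exact hc₁
    · rw [min_eq_right hle]; exact hc₂
  exact ObsStiffnessSeqCeilingAt_tp0_on_segment_of_kinWord_orbitLowerBoxRowW (le_of_lt (by exact_mod_cast hn₂))
    hbox hflo hcap c hmin

end AffineN

/-! ## §3 The `(U-ray) × (filling segment)` rectangle at `t' = 0` from ONE kinetic-word certificate -/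

section Rectangle

variable {U₀ : ℝ} {n₁ n₂ : ℝ} {r : ℚ} {flo cap : (Fin 3 → ℝ) → ℝ}

/-- **Kinetic-word leaf on the rectangle `[U₀, ∞) × [n₁, n₂]` (`t' = 0`) from a box WINDOW row on the segment at `U₀`**
(`0 ≤ U₀`, `0 ≤ n₁`, `n₂ < 2`; window discharged on the segment): for every `U ≥ U₀`, every `x ∈ [n₁, n₂]` and every
`c ≥ −r/4`, `ObsStiffnessSeqCeilingAt 0 U x c` — the density leg (this file) composed with the `U`-ray (kinetic energy
non-increasing in `U` on the torus-limit ground-state classes, `ObsStiffnessSeqCeilingAt_tp0_on_ray_of_kinWord_orbitLowerRow`).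
[cite: Griffiths1966, §II] -/
theorem ObsStiffnessSeqCeilingAt_tp0_on_rectangle_of_kinWord_orbitLowerBoxRowW (hU₀ : 0 ≤ U₀) (hn₁ : 0 ≤ n₁)
    (hn₂ : n₂ < 2)
    (h : SquareTTPrimeCorrOrbitLowerBoxRowW ![U₀, 0, n₁] ![U₀, 0, n₂] flo cap r Finset.univ kinWindow kinWord)
    (hflo : ∀ θ ∈ Set.Icc ![U₀, 0, n₁] ![U₀, 0, n₂], flo θ ≤ energyDensityTT' 1 (θ 1) (θ 0) (θ 2))
    (hcap : ∀ θ ∈ Set.Icc ![U₀, 0, n₁] ![U₀, 0, n₂], energyDensityTT' 1 (θ 1) (θ 0) (θ 2) ≤ cap θ)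
    (c : ℚ) (hc : -r / 4 ≤ c) :
    ∀ U : ℝ, U₀ ≤ U → ∀ x ∈ Set.Icc n₁ n₂, ObsStiffnessSeqCeilingAt 0 U x c := by
  intro U hU x hx
  obtain ⟨u, hu⟩ := exists_rat_gt (energyDensityTT' 1 0 U₀ x)
  exact ObsStiffnessSeqCeilingAt_tp0_on_ray_of_kinWord_orbitLowerRow hU₀ hU (hn₁.trans hx.1) (lt_of_le_of_lt hx.2 hn₂)
    (h.orbitLowerRow_of_segment hflo hcap hx u) hu.le c hc

/-- **Kinetic-word leaf on the rectangle `[U₀, ∞) × [n₁, n₂]` (`t' = 0`) from a cap-only box row on the segment at `U₀`**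
(`boxdual/0` shape; cap discharged). [cite: Griffiths1966, §II] -/
theorem ObsStiffnessSeqCeilingAt_tp0_on_rectangle_of_kinWord_orbitLowerBoxRow (hU₀ : 0 ≤ U₀) (hn₁ : 0 ≤ n₁)
    (hn₂ : n₂ < 2)
    (h : SquareTTPrimeCorrOrbitLowerBoxRow ![U₀, 0, n₁] ![U₀, 0, n₂] cap r Finset.univ kinWindow kinWord)
    (hcap : ∀ θ ∈ Set.Icc ![U₀, 0, n₁] ![U₀, 0, n₂], energyDensityTT' 1 (θ 1) (θ 0) (θ 2) ≤ cap θ)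
    (c : ℚ) (hc : -r / 4 ≤ c) :
    ∀ U : ℝ, U₀ ≤ U → ∀ x ∈ Set.Icc n₁ n₂, ObsStiffnessSeqCeilingAt 0 U x c := by
  intro U hU x hx
  obtain ⟨u, hu⟩ := exists_rat_gt (energyDensityTT' 1 0 U₀ x)
  have hθ := vec3_mem_fillingSegment (U := U₀) (tp := (0 : ℝ)) hx
  have hrow : SquareTTPrimeCorrOrbitLowerRow 0 U₀ x u r Finset.univ kinWindow kinWord := by
    intro ω Ls ψ hLs hψ hψ1 hω _
    have hh := h.uncond hcap _ hθ ω Ls ψ hLs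
    simp only [Matrix.cons_val_zero, Matrix.cons_val_one, Matrix.head_cons, Matrix.cons_val_two,
      Matrix.tail_cons] at hh
    exact hh hψ hψ1 hω
  exact ObsStiffnessSeqCeilingAt_tp0_on_ray_of_kinWord_orbitLowerRow hU₀ hU (hn₁.trans hx.1)
    (lt_of_le_of_lt hx.2 hn₂) hrow hu.le c hc

/-- **Kinetic-word leaf on the rectangle `[U₀, ∞) × [n₁, n₂]` from ONE affine-N `kinWord` row at the anchor `(U₀, n₀, 0)`**
(density slope `s`, `κhi, κlo ≥ 0`, `0 ≤ U₀`, `0 ≤ n₁ < n₂ < 2`), two certified caps at `(U₀, nᵢ)` and a floor on the segment at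
`U₀`: for every `U ≥ U₀` and every `x ∈ [n₁, n₂]`, `ObsStiffnessSeqCeilingAt 0 U x c` whenever `−vᵢ/4 ≤ c` (`i = 1, 2`),
`vᵢ = q + s(nᵢ − n₀) + κhi(hi − uᵢ) + κlo(lo' − lo)`. One certificate, two endpoint evaluations, a whole rectangle of the
`(U, n)` plane. [cite: Griffiths1966, §II] -/
theorem ObsStiffnessSeqCeilingAt_tp0_on_rectangle_of_affineKinWord_orbitRowN {q hi lo κhi κlo s n₀ : ℚ}
    (hU₀ : 0 ≤ U₀)
    (h : SquareTTPrimeCorrAffineOrbitLowerRowN 0 U₀ q hi lo κhi κlo s n₀ Finset.univ kinWindow kinWord)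
    (hκhi : 0 ≤ κhi) (hκlo : 0 ≤ κlo) {n₁ n₂ u₁ u₂ lo' : ℚ} (hn₁ : 0 ≤ n₁) (h12 : n₁ < n₂) (hn₂ : n₂ < 2)
    (hu₁ : energyDensityTT' 1 0 U₀ n₁ ≤ ((u₁ : ℚ) : ℝ)) (hu₂ : energyDensityTT' 1 0 U₀ n₂ ≤ ((u₂ : ℚ) : ℝ))
    (hlo' : ∀ x ∈ Set.Icc ((n₁ : ℚ) : ℝ) ((n₂ : ℚ) : ℝ), ((lo' : ℚ) : ℝ) ≤ energyDensityTT' 1 0 U₀ x)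
    (c : ℚ) (hc₁ : -(q + s * (n₁ - n₀) + κhi * (hi - u₁) + κlo * (lo' - lo)) / 4 ≤ c)
    (hc₂ : -(q + s * (n₂ - n₀) + κhi * (hi - u₂) + κlo * (lo' - lo)) / 4 ≤ c) :
    ∀ U : ℝ, U₀ ≤ U → ∀ x ∈ Set.Icc ((n₁ : ℚ) : ℝ) ((n₂ : ℚ) : ℝ), ObsStiffnessSeqCeilingAt 0 U x c := by
  have hbox := h.orbitLowerBoxRowW_segment_chord hκhi hκlo hn₁ h12 hn₂
    (r' := min (q + s * (n₁ - n₀) + κhi * (hi - u₁) + κlo * (lo' - lo))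
      (q + s * (n₂ - n₀) + κhi * (hi - u₂) + κlo * (lo' - lo))) (min_le_left _ _) (min_le_right _ _)
  have hflo : ∀ θ ∈ Set.Icc ![U₀, (0 : ℝ), ((n₁ : ℚ) : ℝ)] ![U₀, (0 : ℝ), ((n₂ : ℚ) : ℝ)],
      (fun _ : Fin 3 → ℝ => ((lo' : ℚ) : ℝ)) θ ≤ energyDensityTT' 1 (θ 1) (θ 0) (θ 2) := by
    intro θ hθ
    obtain ⟨h0, h1, hx1, hx2⟩ := mem_fillingSegment_iff.1 hθ
    rw [h0, h1]
    exact hlo' (θ 2) ⟨hx1, hx2⟩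
  have hcap := energyDensityTT'_le_chordCap_of_mem_fillingSegment (tp := (0 : ℝ)) hU₀
    (show (0 : ℝ) ≤ ((n₁ : ℚ) : ℝ) by exact_mod_cast hn₁) (show ((n₁ : ℚ) : ℝ) < ((n₂ : ℚ) : ℝ) by exact_mod_cast h12)
    (show ((n₂ : ℚ) : ℝ) < 2 by exact_mod_cast hn₂) hu₁ hu₂
  have hmin : -min (q + s * (n₁ - n₀) + κhi * (hi - u₁) + κlo * (lo' - lo))
      (q + s * (n₂ - n₀) + κhi * (hi - u₂) + κlo * (lo' - lo)) / 4 ≤ c := by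
    rcases le_total (q + s * (n₁ - n₀) + κhi * (hi - u₁) + κlo * (lo' - lo))
        (q + s * (n₂ - n₀) + κhi * (hi - u₂) + κlo * (lo' - lo)) with hle | hle
    · rw [min_eq_left hle]; exact hc₁
    · rw [min_eq_right hle]; exact hc₂
  exact ObsStiffnessSeqCeilingAt_tp0_on_rectangle_of_kinWord_orbitLowerBoxRowW hU₀ (by exact_mod_cast hn₁)
    (by exact_mod_cast hn₂) hbox hflo hcap c hmin

end Rectangle

end Summit.Ventures.CertifiedManyBodySolver.Observables

end
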